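import Summits.RiemannHypothesis.RiemannHypothesis.Theorems.IntegerScrewDiscreteLandau
import Literature.NumberTheory.LFunctions.FordZetaZeroRecipSqSum
import HarnessLib

/-!
# Crux `ScrewPolyFloor` (stmt-RiemannHypothesis-15757) — negative lemma: the diagonal of `S_M` has no uniform positive margin

The deciding theorem of route IntegerScrew consumes the crux ONLY through its diagonal
(`x = 𝟙_m` gives `c·m^{-A} ≤ G(log m, log m) = 2Ψ(log m)`).  The natural strengthening of that
consequence — a UNIFORM positive diagonal margin `Ψ(log m) ≥ c > 0` for all `m ≥ 2` — is FALSE,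
unconditionally (`zetaScrew_log_not_uniformly_positive`).  More precisely
(`exists_zetaScrew_log_lt`): for every `ε > 0` and every `m₀` there is a node `m ≥ m₀` with
`Ψ(log m) < ε`, i.e. `liminf_{m → ∞} Ψ(log m) ≤ 0` — with NO hypothesis.  Proof by cases:

* under RH (`exists_zetaScrew_log_lt_of_RH`): `Ψ(t) = Σ_ρ m(ρ)(1 − cos γt)/γ²` (tree
  `ZetaScrewThm17.hasSum_real`), the weights `m(ρ)/γ² ≤ 2m(ρ)/‖ρ‖²` are summable (tree
  `FordL33.summable_order_div_norm_sq`), so a finite head carries all but `ε/2`; Dirichlet's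
  simultaneous approximation theorem (`dirichlet_simultaneous`, pigeonhole — proved here) makes every
  head phase `γ t` close to `2πℤ` at some `t = qτ ≥ τ`, and the node `m = ⌊e^t⌋` moves each phase by at
  most `|γ|·2e^{−τ}`; hence the head is `≤ ε/4` at `log m`;
* under `¬RH` (`exists_zetaScrew_log_lt_neg_of_not_RH`): `Ψ∘log` is even unbounded below on `ℕ`,
  by the tree's Landau engine (`nodeSlack` + `robustLandau` + `quasiRiemannHypothesis_one_half_iff_holds`,
  the tail of `DiscreteLandau_proof`).

Read on the crux (`screwPolyFloor_diag_not_uniform`): the diagonal entries `G(log m, log m)` of the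
matrices `S_M` are not bounded away from `0`, so no argument can certify the floor through a uniform
diagonal margin (diagonal dominance, Gershgorin discs around `2Ψ(log m) ≥ 2c`, …); together with
`Negative/ScrewPolyFloorExponent` (`A ≥ 1`) and the tightness `c·m^{-A} ≤ 2Ψ(log m)` this pins what a
proof must produce.  Refuter, cdisprove cycle 1.  Theorems only.
-/

noncomputable section

namespace Summit.RiemannHypothesis.Cruxes.ScrewPolyFloor.Negative

open Literature.NumberTheory.LFunctions Filter Topology
open Summit.RiemannHypothesis.RiemannHypothesis.Theorems
open scoped BigOperators


/-- **Dirichlet's simultaneous approximation theorem** (pigeonhole). -/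
theorem dirichlet_simultaneous {ι : Type*} [Fintype ι] [DecidableEq ι] (α : ι → ℝ) {Q : ℕ}
    (hQ : 0 < Q) :
    ∃ q : ℕ, 0 < q ∧ q ≤ Q ^ Fintype.card ι ∧ ∀ i, ∃ k : ℤ, |(q : ℝ) * α i - k| < 1 / Q := by
  classical
  set N := Q ^ Fintype.card ι with hN
  have hQr : (0 : ℝ) < Q := by exact_mod_cast hQ
  have hbox : ∀ (j : ℕ) (i : ι), ⌊(Q : ℝ) * Int.fract ((j : ℝ) * α i)⌋₊ < Q := by
    intro j i
    rw [Nat.floor_lt (mul_nonneg hQr.le (Int.fract_nonneg _))]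
    have := Int.fract_lt_one ((j : ℝ) * α i)
    calc (Q : ℝ) * Int.fract ((j : ℝ) * α i) < Q * 1 := by
          exact mul_lt_mul_of_pos_left this hQr
      _ = Q := mul_one _
  let f : Fin (N + 1) → (ι → Fin Q) := fun j i =>
    ⟨⌊(Q : ℝ) * Int.fract (((j : ℕ) : ℝ) * α i)⌋₊, hbox j i⟩
  have hcard : Fintype.card (ι → Fin Q) < Fintype.card (Fin (N + 1)) := by
    simp [Fintype.card_fin, hN]
  obtain ⟨j₁, j₂, hne, heq⟩ := Fintype.exists_ne_map_eq_of_card_lt f hcard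
  wlog hlt : (j₁ : ℕ) < j₂ generalizing j₁ j₂
  · have hlt' : (j₂ : ℕ) < j₁ := by
      rcases Nat.lt_or_ge (j₁ : ℕ) j₂ with h | h
      · exact absurd h hlt
      · exact lt_of_le_of_ne h (fun h' => hne (Fin.ext h').symm)
    exact this j₂ j₁ hne.symm heq.symm hlt'
  refine ⟨(j₂ : ℕ) - j₁, Nat.sub_pos_of_lt hlt, ?_, fun i => ?_⟩
  · have : (j₂ : ℕ) ≤ N := Nat.lt_succ_iff.mp j₂.isLt
    omega
  · have hi := congr_arg (fun g => ((g i : Fin Q) : ℕ)) heq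
    simp only [f] at hi
    set a₁ := (Q : ℝ) * Int.fract (((j₁ : ℕ) : ℝ) * α i) with ha₁
    set a₂ := (Q : ℝ) * Int.fract (((j₂ : ℕ) : ℝ) * α i) with ha₂
    have h0₁ : 0 ≤ a₁ := mul_nonneg hQr.le (Int.fract_nonneg _)
    have h0₂ : 0 ≤ a₂ := mul_nonneg hQr.le (Int.fract_nonneg _)
    have h1 := Nat.floor_le h0₁
    have h2 := Nat.lt_floor_add_one a₁
    have h3 := Nat.floor_le h0₂
    have h4 := Nat.lt_floor_add_one a₂
    rw [hi] at h1 h2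
    have hdiff : |a₂ - a₁| < 1 := by
      rw [abs_sub_lt_iff]; constructor <;> linarith
    refine ⟨⌊((j₂ : ℕ) : ℝ) * α i⌋ - ⌊((j₁ : ℕ) : ℝ) * α i⌋, ?_⟩
    have hsub : (((j₂ : ℕ) - (j₁ : ℕ) : ℕ) : ℝ) = ((j₂ : ℕ) : ℝ) - ((j₁ : ℕ) : ℝ) := by
      rw [Nat.cast_sub hlt.le]
    rw [hsub]
    have key : (((j₂ : ℕ) : ℝ) - ((j₁ : ℕ) : ℝ)) * α i -
        ((⌊((j₂ : ℕ) : ℝ) * α i⌋ - ⌊((j₁ : ℕ) : ℝ) * α i⌋ : ℤ) : ℝ) =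
        Int.fract (((j₂ : ℕ) : ℝ) * α i) - Int.fract (((j₁ : ℕ) : ℝ) * α i) := by
      rw [Int.fract, Int.fract]
      push_cast
      ring
    rw [key]
    have : |Int.fract (((j₂ : ℕ) : ℝ) * α i) - Int.fract (((j₁ : ℕ) : ℝ) * α i)| =
        |a₂ - a₁| / Q := by
      rw [ha₁, ha₂, ← mul_sub, abs_mul, abs_of_pos hQr]
      field_simp
    rw [this, div_lt_div_iff_of_pos_right hQr]
    exact hdiff

/-- `1/γ² ≤ 2/‖ρ‖²` for a non-trivial zero (`|γ| > 14`, `0 < Re ρ < 1`). -/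
theorem inv_im_sq_le (ρ : ZetaZeros.riemannZetaNontrivialZeros) :
    1 / (ρ : ℂ).im ^ 2 ≤ 2 / ‖(ρ : ℂ)‖ ^ 2 := by
  have hγ : 14 < |(ρ : ℂ).im| := FordL33.fourteen_lt_abs_im ρ
  have hre0 : 0 < (ρ : ℂ).re := ZetaZeros.riemannZetaNontrivialZeros.re_pos ρ.2
  have hre1 : (ρ : ℂ).re < 1 := ZetaZeros.riemannZetaNontrivialZeros.re_lt_one ρ.2
  have hγ2 : 196 < (ρ : ℂ).im ^ 2 := by
    have : (14 : ℝ) ^ 2 < |(ρ : ℂ).im| ^ 2 := by gcongr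
    rw [sq_abs] at this
    linarith
  have hnorm : ‖(ρ : ℂ)‖ ^ 2 = (ρ : ℂ).re ^ 2 + (ρ : ℂ).im ^ 2 := by
    rw [Complex.sq_norm, Complex.normSq_apply]; ring
  have hre2 : (ρ : ℂ).re ^ 2 < 1 := by nlinarith
  rw [div_le_div_iff₀ (by positivity) (by rw [hnorm]; positivity), one_mul, hnorm]
  nlinarith

/-- **Under RH, `Ψ` takes arbitrarily small values at arbitrarily large log-integer nodes**:
`∀ ε > 0, ∀ m₀, ∃ m ≥ m₀, Ψ(log m) < ε`. -/
theorem exists_zetaScrew_log_lt_of_RH (hRH : RiemannHypothesis) {ε : ℝ} (hε : 0 < ε) (m₀ : ℕ) :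
    ∃ m : ℕ, m₀ ≤ m ∧ 2 ≤ m ∧ zetaScrew (Real.log m) < ε := by
  classical
  -- weights `g ρ = 4 m(ρ)/‖ρ‖²`, summable, dominating the series terms
  set g : ZetaZeros.riemannZetaNontrivialZeros → ℝ :=
    fun ρ => 4 * ((riemannZetaZeroOrder (ρ : ℂ) : ℝ) / ‖(ρ : ℂ)‖ ^ 2) with hg
  have hgs : Summable g := (FordL33.summable_order_div_norm_sq).mul_left 4
  have hg0 : ∀ ρ, 0 ≤ g ρ := fun ρ =>
    mul_nonneg (by norm_num) (div_nonneg (FordL33.order_pos ρ).le (sq_nonneg _))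
  -- the series term at `t`
  set f : ℝ → ZetaZeros.riemannZetaNontrivialZeros → ℝ := fun t ρ =>
    (riemannZetaZeroOrder (ρ : ℂ) : ℝ) * ((1 - Real.cos ((ρ : ℂ).im * t)) / (ρ : ℂ).im ^ 2) with hf
  have hfs : ∀ t, HasSum (f t) (zetaScrew t) := fun t => ZetaScrewThm17.hasSum_real hRH t
  have hf0 : ∀ t ρ, 0 ≤ f t ρ := fun t ρ => ZetaScrewThm17.realTerm_nonneg ρ t
  have hfg : ∀ t ρ, f t ρ ≤ g ρ := by
    intro t ρ
    have hm0 : 0 ≤ (riemannZetaZeroOrder (ρ : ℂ) : ℝ) := (FordL33.order_pos ρ).le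
    have hcos : 1 - Real.cos ((ρ : ℂ).im * t) ≤ 2 := by
      linarith [Real.neg_one_le_cos ((ρ : ℂ).im * t)]
    have h1 : (1 - Real.cos ((ρ : ℂ).im * t)) / (ρ : ℂ).im ^ 2 ≤ 2 * (2 / ‖(ρ : ℂ)‖ ^ 2) := by
      calc (1 - Real.cos ((ρ : ℂ).im * t)) / (ρ : ℂ).im ^ 2
          ≤ 2 / (ρ : ℂ).im ^ 2 := div_le_div_of_nonneg_right hcos (sq_nonneg _)
        _ = 2 * (1 / (ρ : ℂ).im ^ 2) := by ring
        _ ≤ 2 * (2 / ‖(ρ : ℂ)‖ ^ 2) := by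
            exact mul_le_mul_of_nonneg_left (inv_im_sq_le ρ) (by norm_num)
    calc f t ρ = (riemannZetaZeroOrder (ρ : ℂ) : ℝ) *
          ((1 - Real.cos ((ρ : ℂ).im * t)) / (ρ : ℂ).im ^ 2) := rfl
      _ ≤ (riemannZetaZeroOrder (ρ : ℂ) : ℝ) * (2 * (2 / ‖(ρ : ℂ)‖ ^ 2)) :=
          mul_le_mul_of_nonneg_left h1 hm0
      _ = g ρ := by rw [hg]; ring
  -- tail: a finite set `F` with `Σ_{ρ ∉ F} g ρ < ε/2`
  have htend := tendsto_tsum_compl_atTop_zero g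
  obtain ⟨F, hF⟩ := ((tendsto_order.1 htend).2 (ε / 2) (by positivity)).exists
  -- total weight and the precision `η`
  set G := ∑' ρ, g ρ with hG
  have hG0 : 0 ≤ G := tsum_nonneg hg0
  set η : ℝ := min 1 (ε / (G + 1)) with hη
  have hη0 : 0 < η := lt_min one_pos (by positivity)
  have hη1 : η ≤ 1 := min_le_left _ _
  have hηε : η ≤ ε / (G + 1) := min_le_right _ _
  -- the height bound `Γ` on `F` and the base step `τ`
  set Γ : ℝ := ∑ ρ ∈ F, |(ρ : ℂ).im| with hΓ
  have hΓ0 : 0 ≤ Γ := Finset.sum_nonneg fun ρ _ => abs_nonneg _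
  have hΓle : ∀ ρ ∈ F, |(ρ : ℂ).im| ≤ Γ := fun ρ hρ => by
    rw [hΓ]
    exact Finset.single_le_sum
      (f := fun ρ' : ZetaZeros.riemannZetaNontrivialZeros => |(ρ' : ℂ).im|)
      (fun ρ' _ => abs_nonneg _) hρ
  set τ : ℝ := max 1 (max (m₀ : ℝ) (4 * Γ / η)) with hτ
  have hτ1 : 1 ≤ τ := le_max_left _ _
  have hτm₀ : (m₀ : ℝ) ≤ τ := le_trans (le_max_left _ _) (le_max_right _ _)
  have hτΓ : 4 * Γ / η ≤ τ := le_trans (le_max_right _ _) (le_max_right _ _)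
  have hτ0 : 0 < τ := by linarith
  -- Dirichlet on the finitely many frequencies `γ τ / 2π`, precision `1/Q ≤ η/(4π)`
  set Q : ℕ := ⌈4 * Real.pi / η⌉₊ with hQ
  have hQpos : 0 < Q := by
    rw [hQ, Nat.ceil_pos]; positivity
  have hQge : 4 * Real.pi / η ≤ Q := Nat.le_ceil _
  have hQr : (0 : ℝ) < Q := by exact_mod_cast hQpos
  obtain ⟨q, hq, -, hk⟩ := dirichlet_simultaneous
    (fun ρ : F => ((ρ : ZetaZeros.riemannZetaNontrivialZeros) : ℂ).im * τ / (2 * Real.pi)) hQpos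
  -- the node
  set t : ℝ := q * τ with ht
  have hq1 : (1 : ℝ) ≤ q := by exact_mod_cast hq
  have htτ : τ ≤ t := by
    rw [ht]; nlinarith
  have ht1 : 1 ≤ t := le_trans hτ1 htτ
  set m : ℕ := ⌊Real.exp t⌋₊ with hm
  have hexp1 : t + 1 ≤ Real.exp t := Real.add_one_le_exp t
  have hmle : (m : ℝ) ≤ Real.exp t := Nat.floor_le (Real.exp_pos t).le
  have hmlt : Real.exp t < m + 1 := Nat.lt_floor_add_one _
  have hm2 : 2 ≤ m := by
    rw [hm, Nat.le_floor_iff (Real.exp_pos t).le]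
    push_cast; linarith
  have hmm₀ : m₀ ≤ m := by
    rw [hm, Nat.le_floor_iff (Real.exp_pos t).le]
    linarith
  have hmpos : (0 : ℝ) < m := by exact_mod_cast (by omega : 0 < m)
  -- `0 ≤ t - log m ≤ 1/m ≤ 2 e^{-t} ≤ 2 e^{-τ}`
  have hlogm : Real.log m ≤ t := by
    have := Real.log_le_log hmpos hmle
    rwa [Real.log_exp] at this
  have hdiff : t - Real.log m ≤ 2 * Real.exp (-τ) := by
    have h1 : t < Real.log ((m : ℝ) + 1) := by
      have := Real.log_lt_log (Real.exp_pos t) hmlt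
      rwa [Real.log_exp] at this
    have h2 : Real.log ((m : ℝ) + 1) - Real.log m ≤ 1 / m := by
      rw [← Real.log_div (by positivity) hmpos.ne']
      have := Real.log_le_sub_one_of_pos (show (0 : ℝ) < ((m : ℝ) + 1) / m by positivity)
      have e : ((m : ℝ) + 1) / m - 1 = 1 / m := by field_simp; ring
      linarith
    have h3 : 1 / (m : ℝ) ≤ 2 * Real.exp (-t) := by
      rw [Real.exp_neg, div_le_iff₀ hmpos]
      have : Real.exp t < 2 * m := by
        have : (1 : ℝ) ≤ m := by exact_mod_cast (by omega : 1 ≤ m)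
        linarith
      rw [show 2 * (Real.exp t)⁻¹ * (m : ℝ) = 2 * m / Real.exp t by field_simp]
      rw [le_div_iff₀ (Real.exp_pos t)]
      linarith
    have h4 : Real.exp (-t) ≤ Real.exp (-τ) := Real.exp_le_exp.2 (by linarith)
    linarith
  have hdiff0 : 0 ≤ t - Real.log m := by linarith
  -- `2 Γ e^{-τ} ≤ η / 2`
  have hΓτ : 2 * Γ * Real.exp (-τ) ≤ η / 2 := by
    have he : τ + 1 ≤ Real.exp τ := Real.add_one_le_exp τ
    have h1 : 4 * Γ ≤ η * τ := by
      rw [div_le_iff₀ hη0] at hτΓ; linarith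
    have h2 : η * τ ≤ η * Real.exp τ := mul_le_mul_of_nonneg_left (by linarith) hη0.le
    rw [Real.exp_neg]
    rw [show 2 * Γ * (Real.exp τ)⁻¹ = 2 * Γ / Real.exp τ by ring, div_le_iff₀ (Real.exp_pos τ)]
    linarith
  -- head bound, term by term
  have hhead : ∀ ρ ∈ F, f (Real.log m) ρ ≤ η ^ 2 / 4 * g ρ := by
    intro ρ hρ
    obtain ⟨k, hk'⟩ := hk ⟨ρ, hρ⟩
    simp only at hk'
    -- the reduced angle
    set θ : ℝ := (ρ : ℂ).im * Real.log m - k * (2 * Real.pi) with hθ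
    have hθt : |(ρ : ℂ).im * t - k * (2 * Real.pi)| < η / 2 := by
      have e : (ρ : ℂ).im * t - k * (2 * Real.pi) =
          2 * Real.pi * ((q : ℝ) * ((ρ : ℂ).im * τ / (2 * Real.pi)) - k) := by
        rw [ht]; field_simp
      rw [e, abs_mul, abs_of_pos (by positivity : (0 : ℝ) < 2 * Real.pi)]
      have hπQ : 2 * Real.pi * (1 / (Q : ℝ)) ≤ η / 2 := by
        rw [div_le_iff₀ hη0] at hQge
        rw [show 2 * Real.pi * (1 / (Q : ℝ)) = 2 * Real.pi / Q by ring, div_le_iff₀ hQr]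
        linarith
      calc 2 * Real.pi * |(q : ℝ) * ((ρ : ℂ).im * τ / (2 * Real.pi)) - k|
          < 2 * Real.pi * (1 / Q) := mul_lt_mul_of_pos_left hk' (by positivity)
        _ ≤ η / 2 := hπQ
    have hθm : |(ρ : ℂ).im * Real.log m - (ρ : ℂ).im * t| ≤ η / 2 := by
      rw [← mul_sub, abs_mul, abs_sub_comm, abs_of_nonneg hdiff0]
      calc |(ρ : ℂ).im| * (t - Real.log m) ≤ Γ * (2 * Real.exp (-τ)) :=
            mul_le_mul (hΓle ρ hρ) hdiff hdiff0 hΓ0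
        _ = 2 * Γ * Real.exp (-τ) := by ring
        _ ≤ η / 2 := hΓτ
    have hθle : |θ| ≤ η := by
      have e : θ = ((ρ : ℂ).im * Real.log m - (ρ : ℂ).im * t) +
          ((ρ : ℂ).im * t - k * (2 * Real.pi)) := by rw [hθ]; ring
      rw [e]
      calc |((ρ : ℂ).im * Real.log m - (ρ : ℂ).im * t) + ((ρ : ℂ).im * t - k * (2 * Real.pi))|
          ≤ |(ρ : ℂ).im * Real.log m - (ρ : ℂ).im * t| + |(ρ : ℂ).im * t - k * (2 * Real.pi)| :=
            abs_add_le _ _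
        _ ≤ η / 2 + η / 2 := add_le_add hθm hθt.le
        _ = η := by ring
    have hcos : 1 - Real.cos ((ρ : ℂ).im * Real.log m) ≤ η ^ 2 / 2 := by
      have e : (ρ : ℂ).im * Real.log m = θ + k * (2 * Real.pi) := by rw [hθ]; ring
      rw [e, Real.cos_add_int_mul_two_pi]
      have h1 := Real.one_sub_sq_div_two_le_cos (x := θ)
      have h2 : θ ^ 2 ≤ η ^ 2 := by
        rw [← sq_abs θ]; exact pow_le_pow_left₀ (abs_nonneg θ) hθle 2
      linarith
    have hm0 : 0 ≤ (riemannZetaZeroOrder (ρ : ℂ) : ℝ) := (FordL33.order_pos ρ).le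
    calc f (Real.log m) ρ = (riemannZetaZeroOrder (ρ : ℂ) : ℝ) *
          ((1 - Real.cos ((ρ : ℂ).im * Real.log m)) / (ρ : ℂ).im ^ 2) := rfl
      _ ≤ (riemannZetaZeroOrder (ρ : ℂ) : ℝ) * ((η ^ 2 / 2) * (2 / ‖(ρ : ℂ)‖ ^ 2)) := by
          apply mul_le_mul_of_nonneg_left _ hm0
          calc (1 - Real.cos ((ρ : ℂ).im * Real.log m)) / (ρ : ℂ).im ^ 2
              ≤ (η ^ 2 / 2) / (ρ : ℂ).im ^ 2 := div_le_div_of_nonneg_right hcos (sq_nonneg _)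
            _ = (η ^ 2 / 2) * (1 / (ρ : ℂ).im ^ 2) := by ring
            _ ≤ (η ^ 2 / 2) * (2 / ‖(ρ : ℂ)‖ ^ 2) :=
                mul_le_mul_of_nonneg_left (inv_im_sq_le ρ) (by positivity)
      _ = η ^ 2 / 4 * g ρ := by rw [hg]; ring
  -- assemble: Ψ(log m) = head + tail
  have hsum : ∑ ρ ∈ F, f (Real.log m) ρ + ∑' ρ : ↥((F : Set ZetaZeros.riemannZetaNontrivialZeros)ᶜ), f (Real.log m) (ρ : ZetaZeros.riemannZetaNontrivialZeros) =
      zetaScrew (Real.log m) := by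
    rw [(hfs (Real.log m)).summable.sum_add_tsum_compl, (hfs (Real.log m)).tsum_eq]
  have hheadsum : ∑ ρ ∈ F, f (Real.log m) ρ ≤ η ^ 2 / 4 * G := by
    calc ∑ ρ ∈ F, f (Real.log m) ρ ≤ ∑ ρ ∈ F, η ^ 2 / 4 * g ρ := Finset.sum_le_sum hhead
      _ = η ^ 2 / 4 * ∑ ρ ∈ F, g ρ := by rw [Finset.mul_sum]
      _ ≤ η ^ 2 / 4 * G := by
          apply mul_le_mul_of_nonneg_left _ (by positivity)
          exact hgs.sum_le_tsum F (fun ρ _ => hg0 ρ)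
  have htailsum : ∑' ρ : ↥((F : Set ZetaZeros.riemannZetaNontrivialZeros)ᶜ), f (Real.log m) (ρ : ZetaZeros.riemannZetaNontrivialZeros) ≤
      ∑' ρ : ↥((F : Set ZetaZeros.riemannZetaNontrivialZeros)ᶜ), g (ρ : ZetaZeros.riemannZetaNontrivialZeros) := by
    apply Summable.tsum_le_tsum (fun ρ => hfg _ _)
    · exact (hfs (Real.log m)).summable.subtype _
    · exact hgs.subtype _
  have htail' : ∑' ρ : ↥((F : Set ZetaZeros.riemannZetaNontrivialZeros)ᶜ), g (ρ : ZetaZeros.riemannZetaNontrivialZeros) < ε / 2 := hF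
  have hheadε : η ^ 2 / 4 * G ≤ ε / 4 := by
    have h1 : η ^ 2 / 4 * G ≤ η / 4 * G := by
      apply mul_le_mul_of_nonneg_right _ hG0
      have : η ^ 2 ≤ η := by nlinarith
      linarith
    have h2 : η * G ≤ ε := by
      calc η * G ≤ ε / (G + 1) * G := mul_le_mul_of_nonneg_right hηε hG0
        _ ≤ ε := by
            rw [div_mul_eq_mul_div, div_le_iff₀ (by positivity)]
            nlinarith
    linarith
  refine ⟨m, hmm₀, hm2, ?_⟩
  rw [← hsum]
  linarith


/-- **`¬RH` branch**: if RH fails, `Ψ∘log` is unbounded below on `ℕ` (contrapositive of the tree's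
Landau engine: `Ψ(log m) ≥ −K` for all `m ≥ 1` ⇒ `Ψ ≥ −K − 6` on `[0,∞)` (`nodeSlack`) ⇒ no zero of
`ξ(1/2 + ·)` in `Re > 0` (`robustLandau`) ⇒ RH). -/
theorem exists_zetaScrew_log_lt_neg_of_not_RH (hRH : ¬ RiemannHypothesis) (K : ℝ) :
    ∃ m : ℕ, 1 ≤ m ∧ zetaScrew (Real.log m) < -K := by
  by_contra hcon
  have hd : ∀ m : ℕ, 1 ≤ m → -K ≤ zetaScrew (Real.log m) := by
    intro m hm
    by_contra hlt
    exact hcon ⟨m, hm, lt_of_not_ge hlt⟩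
  apply hRH
  obtain ⟨K₆, hK₆⟩ := IntegerScrewDiscreteLandau.nodeSlack
  have hbdd : ∀ t : ℝ, 0 ≤ t → -(K + K₆) ≤ zetaScrew t := by
    intro t ht
    have hfloor : 1 ≤ ⌊Real.exp t⌋₊ := (Nat.one_le_floor_iff _).2 (Real.one_le_exp ht)
    have hnode := hd _ hfloor
    have hint := hK₆ t ht
    linarith
  refine quasiRiemannHypothesis_one_half_iff_holds.1 fun s hs h1' h2' => ?_
  have hξ : riemannXi s = 0 := (riemannXi_eq_zero_iff_holds s).2 ⟨hs, by linarith, h2'⟩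
  have hw : 0 < (s - 1 / 2).re := by simp; linarith
  refine IntegerScrewDiscreteLandau.robustLandau (K + K₆) hbdd (s - 1 / 2) hw ?_
  rw [show (1 / 2 : ℂ) + (s - 1 / 2) = s by ring]
  exact hξ

/-- **Unconditionally, `liminf_{m → ∞} Ψ(log m) ≤ 0`**: for every `ε > 0` and `m₀` there is a node
`m ≥ max m₀ 2` with `Ψ(log m) < ε`. -/
theorem exists_zetaScrew_log_lt {ε : ℝ} (hε : 0 < ε) (m₀ : ℕ) :
    ∃ m : ℕ, m₀ ≤ m ∧ 2 ≤ m ∧ zetaScrew (Real.log m) < ε := by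
  by_cases hRH : RiemannHypothesis
  · exact exists_zetaScrew_log_lt_of_RH hRH hε m₀
  · by_contra hcon
    have hge : ∀ m : ℕ, m₀ ≤ m → 2 ≤ m → ε ≤ zetaScrew (Real.log m) := by
      intro m h1 h2
      by_contra hlt
      exact hcon ⟨m, h1, h2, lt_of_not_ge hlt⟩
    set K₀ : ℝ := ∑ m ∈ Finset.range (max m₀ 2), |zetaScrew (Real.log m)| with hK₀
    have hK₀0 : 0 ≤ K₀ := Finset.sum_nonneg fun m _ => abs_nonneg _
    obtain ⟨m, hm1, hlt⟩ := exists_zetaScrew_log_lt_neg_of_not_RH hRH K₀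
    rcases Nat.lt_or_ge m (max m₀ 2) with hsmall | hbig
    · have hmem : m ∈ Finset.range (max m₀ 2) := Finset.mem_range.2 hsmall
      have habs : |zetaScrew (Real.log m)| ≤ K₀ := by
        rw [hK₀]
        exact Finset.single_le_sum (f := fun m : ℕ => |zetaScrew (Real.log m)|)
          (fun m _ => abs_nonneg _) hmem
      have := neg_abs_le (zetaScrew (Real.log m))
      linarith
    · have h := hge m (le_trans (le_max_left _ _) hbig) (le_trans (le_max_right _ _) hbig)
      linarith

/-- **Natural strengthening refuted**: there is NO uniform positive margin on the diagonal,
`¬ ∃ c > 0, ∀ m ≥ 2, c ≤ Ψ(log m)` (unconditionally). -/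
theorem zetaScrew_log_not_uniformly_positive :
    ¬ (∃ c : ℝ, 0 < c ∧ ∀ m : ℕ, 2 ≤ m → c ≤ zetaScrew (Real.log m)) := by
  rintro ⟨c, hc, h⟩
  obtain ⟨m, -, hm2, hlt⟩ := exists_zetaScrew_log_lt hc 2
  exact absurd (h m hm2) (not_le.2 hlt)

/-- Read on the crux's matrices: **the diagonal entries `G(log m, log m) = 2Ψ(log m)` of the `S_M`
are not bounded away from `0`** — for every `c > 0` some level `M` has a diagonal entry `< c`. -/
theorem screwPolyFloor_diag_not_uniform :
    ¬ (∃ c : ℝ, 0 < c ∧ ∀ M : ℕ, ∀ m ∈ Finset.Icc 2 M,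
        c ≤ zetaScrewKernel (Real.log m) (Real.log m)) := by
  rintro ⟨c, hc, h⟩
  obtain ⟨m, -, hm2, hlt⟩ := exists_zetaScrew_log_lt (half_pos hc) 2
  have hmem : m ∈ Finset.Icc 2 m := Finset.mem_Icc.2 ⟨hm2, le_rfl⟩
  have h1 := h m m hmem
  rw [zetaScrewKernel_self] at h1
  linarith

end Summit.RiemannHypothesis.Cruxes.ScrewPolyFloor.Negative

end
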